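import Mathlib

/-!
# The IMAGINARY pole law, derived: residue lemma and valuation bookkeeping (ENGINE B, pub-hlocus abs-2 g50)

certified instances and evidence bearing on the general Hodge conjecture; no claim.

Kernel-checked cores of DERIVATIONS_engineB §68.7.  In the w-model an IMAGINARY class of a ζ₃-type discriminant
is a unit `w` of `ℤ₃[ζ]` (`ζ` a primitive cube root of unity, `π = 2ζ + 1 = √-3`) with `N(w) = 4 - Ỹ²`,
`β = v₃(Ỹ) ≥ 1`, and its θ-level against the pole vector `P_ζ′` (`ζ′ ∈ μ₆`) of the IMAGINARY pole is
`min (1 + v_π(w - 2ζ′)) (2β + 1)`.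
* `residue_triple` (LEMMA P1): modulo `π² = -3` — i.e. in `ℤ[ζ]/(3) = {p + qζ : p, q ∈ 𝔽₃}` — a unit `w`
  is `≡ 2ζ′ (mod π)` for exactly three `ζ′ ∈ μ₆` and `≡ 2ζ′ (mod π²)` for exactly one of them; hence
  `{v_π(w - 2ζ′)} = {k, 1, 1, 0, 0, 0}` with `k ≥ 2` and the pole pattern is `{L, 2, 2, 1, 1, 1}`,
  `L = min (1 + k) (2β + 1)`, pattern sum `L + 7`.
* `p2_bookkeeping` (LEMMA P2): the valuation facts extracted from the norm identity
  `u(u + 4) = -(3v² + Ỹ²)` and the reflection identity `w - ζ′²w̄ = 2ζ′vπ` force `min k 2β = min κ 2β`,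
  i.e. `L = H_σ = min (2β+1) (1+κ)`.
* `parity_corollary`: `κ` odd ⇒ `H_σ = 2β + 1` or `H_σ` even (census: 1350 + 440 of 1790 IMAG classes, 0 odd-smaller).
Registered check P-IMAGPOLE: shape / law / sub-cases hold for 172 + 1618 + 1480 IMAG classes (|D| ≤ 7200), 0 violations.
-/

set_option linter.dupNamespace false

namespace Summit.HodgeConjecture.HodgeConjecture.HodgeLocus.Census.ImagPoleB

/-- The six units `μ₆ = {1, ζ, ζ², -1, -ζ, -ζ²}` of `ℤ[ζ]` as coefficient pairs `(p, q) ↔ p + qζ` reduced mod 3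
(`ζ² = -1 - ζ`). -/
def mu6 : List (ℕ × ℕ) := [(1, 0), (0, 1), (2, 2), (2, 0), (0, 2), (1, 1)]

/-- `w ≡ 2ζ′ (mod π)`: reduction mod `π` is `p + qζ ↦ p + q ∈ 𝔽₃` (`ζ ≡ 1 mod π`). -/
def congPi (w z : ℕ × ℕ) : Bool := (w.1 + w.2) % 3 == (2 * z.1 + 2 * z.2) % 3

/-- `w ≡ 2ζ′ (mod π²)`, `π² = -3`: componentwise congruence mod 3. -/
def congPiSq (w z : ℕ × ℕ) : Bool := w.1 % 3 == (2 * z.1) % 3 && w.2 % 3 == (2 * z.2) % 3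

/-- LEMMA P1 (residue triple).  For every unit `w = p + qζ` of `ℤ[ζ]/(3)` (`p + q ≢ 0 mod 3`): exactly three
`ζ′ ∈ μ₆` have `w ≡ 2ζ′ (mod π)` and exactly one has `w ≡ 2ζ′ (mod π²)`.  Consequently the six valuations
`v_π(w - 2ζ′)` are `{k, 1, 1, 0, 0, 0}` with `k ≥ 2`. -/
theorem residue_triple :
    ∀ p q : Fin 3, (p.val + q.val) % 3 ≠ 0 →
      (mu6.filter (congPi (p.val, q.val))).length = 3 ∧
      (mu6.filter (congPiSq (p.val, q.val))).length = 1 := by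
  decide

/-- The one `ζ′` with `w ≡ 2ζ′ (mod π²)` lies inside the triple with `w ≡ 2ζ′ (mod π)`. -/
theorem deep_inside_triple :
    ∀ p q : Fin 3, ∀ z ∈ mu6, congPiSq (p.val, q.val) z = true → congPi (p.val, q.val) z = true := by
  decide

/-- LEMMA P2 (bookkeeping).  Notation of §68.7: `k = v_π(x) = min (2a) (2b+1)` for `x = ζ̄′w - 2 = u + vπ`,
`a = v₃(u) ≥ 1`, `b = v₃(v)`; the norm identity `u(u+4) = -(3v² + Ỹ²)` gives `a = min (2b+1) (2β)`; the
reflection identity gives `κ ≥ 2b + 1`, with equality `κ = 2b + 1` when `k = 2b + 1 < 2β` (then the other two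
reflections sit at valuation 1).  Conclusion: `min k (2β) = min κ (2β)`, i.e. the pole level
`L = min (1+k) (2β+1)` equals `H_σ = min (2β+1) (1+κ)`. -/
theorem p2_bookkeeping (a b β k κ : ℕ) (ha : 1 ≤ a)
    (hk1 : 2 * a ≤ 2 * b + 1 → k = 2 * a) (hk2 : 2 * b + 1 < 2 * a → k = 2 * b + 1)
    (hn1 : 2 * b + 1 ≤ 2 * β → a = 2 * b + 1) (hn2 : 2 * β < 2 * b + 1 → a = 2 * β)
    (hr1 : 2 * b + 1 ≤ κ) (hr2 : k = 2 * b + 1 → 2 * b + 1 < 2 * β → κ = 2 * b + 1) :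
    min k (2 * β) = min κ (2 * β) ∧ min (1 + k) (2 * β + 1) = min (2 * β + 1) (1 + κ) := by
  constructor
  · simp only [Nat.min_def]
    split_ifs <;> omega
  · simp only [Nat.min_def]
    split_ifs <;> omega

/-- In the even case the bookkeeping pins `k` down: `k` even ⇒ `k = 4β` (registered clause P2a, 406 + 338 fresh
classes). -/
theorem k_even_eq (a b β k : ℕ)
    (hk1 : 2 * a ≤ 2 * b + 1 → k = 2 * a) (hk2 : 2 * b + 1 < 2 * a → k = 2 * b + 1)
    (hn1 : 2 * b + 1 ≤ 2 * β → a = 2 * b + 1) (hn2 : 2 * β < 2 * b + 1 → a = 2 * β)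
    (heven : k % 2 = 0) : k = 4 * β := by
  omega

/-- Parity corollary (C1): `κ` is odd (a pure-imaginary element `2vπ` has odd `π`-valuation), hence
`H_σ = min (2β+1) (1+κ)` is either `2β + 1` or even — never a smaller odd number. -/
theorem parity_corollary (β κ : ℕ) (hodd : κ % 2 = 1) :
    min (2 * β + 1) (1 + κ) = 2 * β + 1 ∨ min (2 * β + 1) (1 + κ) % 2 = 0 := by
  simp only [Nat.min_def]
  split_ifs <;> omega

/-- Pattern sums (the E-54K dictionary): `L + 2 + 2 + 1 + 1 + 1 = L + 7`; and the number of pole vectors at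
level `≥ n` is `6, 3, 1, 1, …` — three at level `≥ 1` more than at `≥ 2`, matching `residue_triple`. -/
theorem pattern_sum (L : ℕ) : L + 2 + 2 + 1 + 1 + 1 = L + 7 := by omega

end Summit.HodgeConjecture.HodgeConjecture.HodgeLocus.Census.ImagPoleB
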